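import Summits.QuantumFields.YangMills.Theorems.IR.LargeFieldRarityDefs

/-!
# Large-field rarity package, file 2∕5: (FS) the finite-size bound for the torus free energy — PROVED

Landed for item `stmt-QuantumFields-19354` (`--supports … --as helper`) by the LEAD prover ab-p1 under director-ym RULING g9-№2 ∕ №14 (3)
(critic ym-ir-crit-1 GATE 2026-08-28T03:18:39Z: supplier PROVED, land under `Theorems/IR/`); authored by ideator ym-ir-idea-4 g3, split of the
sorry-free workfile `Cruxes/IR/Lines/largefield_rarity_chessboard.lean` v8 per `Cruxes/IR/Lines/largefield_rarity_chessboard_LANDING.md`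
(five files: `LargeFieldRarityDefs` → {`…FiniteSize`, `…Increment`} → `…Engine` → `…OddTori`).

Content: `pow_four_sub_pow_four_le`, the abstract real lemma `abs_sub_limit_le_of_subbox`, `abs_torusLogPartition_sub_density_le` (the tree's sub-box
estimate `FreeEnergy.abs_torusLogPartition_sub_le` used at `(L, m)` and along `L' → ∞` against `exists_hasFreeEnergyDensity_holds`), and
`finiteSizeFreeEnergy : FiniteSizeFreeEnergy` (`|log Z_L(β) − L⁴ f_r(β)| ≤ C(1+|β|)(L⁴/m + L³m)`, `2 ≤ m`, `m² ≤ L`).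

HONESTY.  Nothing here proves the Clay Yang–Mills mass gap, a lattice mass gap, `BalabanLadder.IR`, (T) or (M-b); R4 of the
ladder closes only the conditional finite-𝕋⁴ rung `BalabanLadder.UV`.
-/

noncomputable section

open MeasureTheory Finset
open Literature.MathematicalPhysics.QuantumFieldTheory Literature.MathematicalPhysics.QuantumLattice
open Summit.QuantumFields.YangMills.Theorems (OddTorusChessboard.Orient OddTorusChessboard.wilsonExpectation_expObs_le_exp_card_all
  SoloBlind.expObs)

namespace Summit.QuantumFields.YangMills.Cruxes.IR.LargeFieldRarityChessboard

/-! ## §2b (proved): (FS) from the tree's sub-box estimate and the existence of the density -/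

section FiniteSize

open Filter Topology

/-- `a⁴ − b⁴ ≤ 4a³(a − b)` for `0 ≤ b ≤ a`. -/
theorem pow_four_sub_pow_four_le {a b : ℝ} (hb : 0 ≤ b) (hab : b ≤ a) :
    a ^ 4 - b ^ 4 ≤ 4 * a ^ 3 * (a - b) := by
  have ha : 0 ≤ a := hb.trans hab
  nlinarith [mul_nonneg hb ha, mul_nonneg (mul_nonneg hb hb) ha, mul_nonneg (mul_nonneg hb hb) (mul_nonneg hb ha),
    pow_le_pow_left₀ hb hab 2, pow_le_pow_left₀ hb hab 3, mul_nonneg (sub_nonneg.2 hab) (mul_nonneg ha ha)]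

/-- **Abstract finite-size lemma.**  If a sequence `ψ` satisfies the sub-box estimate
`|ψ L − ⌊L/m⌋⁴ c| ≤ K (L⁴ − ⌊L/m⌋⁴ (m−1)⁴)` at every level, `ψ(L)/L⁴ → f`, and `|c| ≤ K (m−1)⁴`, then
`|ψ L − L⁴ f| ≤ 8K (L⁴/m + L³ m)`. -/
theorem abs_sub_limit_le_of_subbox {ψ : ℕ → ℝ} {f K c : ℝ} {m : ℕ} (hm : 1 ≤ m) (hK : 0 ≤ K)
    (H1 : ∀ L : ℕ, 1 ≤ L → |ψ L - (((L / m) ^ 4 : ℕ) : ℝ) * c| ≤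
      K * ((L : ℝ) ^ 4 - (((L / m) ^ 4 : ℕ) : ℝ) * (((m - 1 : ℕ) : ℝ)) ^ 4))
    (H2 : Tendsto (fun L : ℕ => (((L + 1 : ℕ) : ℝ) ^ 4)⁻¹ * ψ (L + 1)) atTop (𝓝 f))
    (Hc : |c| ≤ K * (((m - 1 : ℕ) : ℝ)) ^ 4) (L : ℕ) (hL : 1 ≤ L) :
    |ψ L - (L : ℝ) ^ 4 * f| ≤ 8 * K * ((L : ℝ) ^ 4 / m + (L : ℝ) ^ 3 * m) := by
  have hmR : (0 : ℝ) < m := by exact_mod_cast hm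
  have hm1R : (((m - 1 : ℕ) : ℝ)) = (m : ℝ) - 1 := by rw [Nat.cast_sub hm, Nat.cast_one]
  have hm1nn : (0 : ℝ) ≤ (m : ℝ) - 1 := by linarith [show (1 : ℝ) ≤ m by exact_mod_cast hm]
  -- Step (a): the limit argument, `|m⁴ f − c| ≤ K (m⁴ − (m−1)⁴)`
  have hb : Tendsto (fun L : ℕ => (((L + 1) / m : ℕ) : ℝ) / ((L + 1 : ℕ) : ℝ)) atTop (𝓝 (1 / m)) :=
    FreeEnergy.tendsto_div_floor m
  set g : ℕ → ℝ := fun L => (((L + 1 : ℕ) : ℝ) ^ 4)⁻¹ * ψ (L + 1) -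
    ((((L + 1) / m : ℕ) : ℝ) / ((L + 1 : ℕ) : ℝ)) ^ 4 * c with hg
  set h : ℕ → ℝ := fun L => K * (1 - ((((L + 1) / m : ℕ) : ℝ) / ((L + 1 : ℕ) : ℝ)) ^ 4 * ((m : ℝ) - 1) ^ 4) with hh
  have hg_t : Tendsto g atTop (𝓝 (f - (1 / m) ^ 4 * c)) := H2.sub ((hb.pow 4).mul_const c)
  have hh_t : Tendsto h atTop (𝓝 (K * (1 - (1 / (m : ℝ)) ^ 4 * ((m : ℝ) - 1) ^ 4))) :=
    (tendsto_const_nhds.sub ((hb.pow 4).mul_const _)).const_mul K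
  have hgh : ∀ L : ℕ, |g L| ≤ h L := by
    intro L
    have hn : (0 : ℝ) < ((L + 1 : ℕ) : ℝ) := by positivity
    have hn4 : (0 : ℝ) < ((L + 1 : ℕ) : ℝ) ^ 4 := by positivity
    have e := H1 (L + 1) (by omega)
    rw [hm1R] at e
    have hq : ((((L + 1) / m) ^ 4 : ℕ) : ℝ) = ((((L + 1) / m : ℕ) : ℝ)) ^ 4 := by push_cast; ring
    rw [hq] at e
    -- divide by n⁴
    have e' : |(ψ (L + 1) - ((((L + 1) / m : ℕ) : ℝ)) ^ 4 * c) / ((L + 1 : ℕ) : ℝ) ^ 4| ≤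
        K * ((((L + 1 : ℕ) : ℝ)) ^ 4 - ((((L + 1) / m : ℕ) : ℝ)) ^ 4 * ((m : ℝ) - 1) ^ 4) / ((L + 1 : ℕ) : ℝ) ^ 4 := by
      rw [abs_div, abs_of_pos hn4]
      exact div_le_div_of_nonneg_right e hn4.le
    have eg : g L = (ψ (L + 1) - ((((L + 1) / m : ℕ) : ℝ)) ^ 4 * c) / ((L + 1 : ℕ) : ℝ) ^ 4 := by
      rw [hg]; field_simp
    have eh : h L = K * ((((L + 1 : ℕ) : ℝ)) ^ 4 - ((((L + 1) / m : ℕ) : ℝ)) ^ 4 * ((m : ℝ) - 1) ^ 4) /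
        ((L + 1 : ℕ) : ℝ) ^ 4 := by
      rw [hh]; field_simp
    rw [eg, eh]; exact e'
  have hlim : |f - (1 / (m : ℝ)) ^ 4 * c| ≤ K * (1 - (1 / (m : ℝ)) ^ 4 * ((m : ℝ) - 1) ^ 4) :=
    le_of_tendsto_of_tendsto' hg_t.abs hh_t hgh
  have ha : |(m : ℝ) ^ 4 * f - c| ≤ K * ((m : ℝ) ^ 4 - ((m : ℝ) - 1) ^ 4) := by
    have hm4 : (0 : ℝ) < (m : ℝ) ^ 4 := by positivity
    have e1 : (m : ℝ) ^ 4 * f - c = (m : ℝ) ^ 4 * (f - (1 / (m : ℝ)) ^ 4 * c) := by field_simp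
    have e2 : K * ((m : ℝ) ^ 4 - ((m : ℝ) - 1) ^ 4) = (m : ℝ) ^ 4 * (K * (1 - (1 / (m : ℝ)) ^ 4 * ((m : ℝ) - 1) ^ 4)) := by
      field_simp
    rw [e1, e2, abs_mul, abs_of_pos hm4]
    exact mul_le_mul_of_nonneg_left hlim hm4.le
  -- |f| ≤ K
  have hf : |f| ≤ K := by
    have hm4 : (0 : ℝ) < (m : ℝ) ^ 4 := by positivity
    rw [hm1R] at Hc
    have h1 : |(m : ℝ) ^ 4 * f| ≤ K * (m : ℝ) ^ 4 := by
      calc |(m : ℝ) ^ 4 * f| = |((m : ℝ) ^ 4 * f - c) + c| := by ring_nf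
        _ ≤ |(m : ℝ) ^ 4 * f - c| + |c| := abs_add_le _ _
        _ ≤ K * ((m : ℝ) ^ 4 - ((m : ℝ) - 1) ^ 4) + K * ((m : ℝ) - 1) ^ 4 := add_le_add ha Hc
        _ = K * (m : ℝ) ^ 4 := by ring
    rw [abs_mul, abs_of_pos hm4] at h1
    nlinarith
  -- Step (b): the three terms at level L
  have e := H1 L hL
  rw [hm1R] at e
  set q : ℝ := ((L / m : ℕ) : ℝ) with hqdef
  have hq4 : (((L / m) ^ 4 : ℕ) : ℝ) = q ^ 4 := by rw [hqdef]; push_cast; ring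
  rw [hq4] at e
  have hq0 : 0 ≤ q := by positivity
  have hqm : q * m ≤ L := by
    rw [hqdef]; exact_mod_cast Nat.div_mul_le_self L m
  have hLq : (L : ℝ) - m ≤ q * m := by
    have := Nat.lt_div_mul_add (a := L) (b := m) (by omega)
    rw [hqdef]
    have h' : (L : ℝ) < ((L / m : ℕ) : ℝ) * m + m := by exact_mod_cast this
    linarith
  have hqL : q ≤ (L : ℝ) / m := by rw [le_div_iff₀ hmR]; exact hqm
  have hL0 : (0 : ℝ) ≤ L := by positivity
  have hL3 : (0 : ℝ) ≤ (L : ℝ) ^ 3 := by positivity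
  -- T3: L⁴ − (qm)⁴ ≤ 4 L³ m
  have T3 : (L : ℝ) ^ 4 - (q * m) ^ 4 ≤ 4 * (L : ℝ) ^ 3 * m := by
    have h1 := pow_four_sub_pow_four_le (by positivity : (0 : ℝ) ≤ q * m) hqm
    have h2 : 4 * (L : ℝ) ^ 3 * ((L : ℝ) - q * m) ≤ 4 * (L : ℝ) ^ 3 * m :=
      mul_le_mul_of_nonneg_left (by linarith) (by positivity)
    linarith
  -- T1: L⁴ − (q(m−1))⁴ ≤ 4 L³ m + 4 L⁴/m
  have T1 : (L : ℝ) ^ 4 - (q * ((m : ℝ) - 1)) ^ 4 ≤ 4 * (L : ℝ) ^ 3 * m + 4 * (L : ℝ) ^ 4 / m := by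
    have hP0 : 0 ≤ q * ((m : ℝ) - 1) := mul_nonneg hq0 hm1nn
    have hPL : q * ((m : ℝ) - 1) ≤ L := by nlinarith
    have h1 := pow_four_sub_pow_four_le hP0 hPL
    have h2 : (L : ℝ) - q * ((m : ℝ) - 1) ≤ m + (L : ℝ) / m := by nlinarith
    have h3 : 4 * (L : ℝ) ^ 3 * ((L : ℝ) - q * ((m : ℝ) - 1)) ≤ 4 * (L : ℝ) ^ 3 * (m + (L : ℝ) / m) :=
      mul_le_mul_of_nonneg_left h2 (by positivity)
    have h4 : 4 * (L : ℝ) ^ 3 * (m + (L : ℝ) / m) = 4 * (L : ℝ) ^ 3 * m + 4 * (L : ℝ) ^ 4 / m := by ring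
    linarith
  -- T2: q⁴ (m⁴ − (m−1)⁴) ≤ 4 L⁴ / m
  have T2 : q ^ 4 * ((m : ℝ) ^ 4 - ((m : ℝ) - 1) ^ 4) ≤ 4 * (L : ℝ) ^ 4 / m := by
    have h1 := pow_four_sub_pow_four_le hm1nn (by linarith : (m : ℝ) - 1 ≤ m)
    have h1' : (m : ℝ) ^ 4 - ((m : ℝ) - 1) ^ 4 ≤ 4 * (m : ℝ) ^ 3 := by nlinarith
    have h2 : q ^ 4 * ((m : ℝ) ^ 4 - ((m : ℝ) - 1) ^ 4) ≤ q ^ 4 * (4 * (m : ℝ) ^ 3) :=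
      mul_le_mul_of_nonneg_left h1' (by positivity)
    have h3 : q ^ 4 * (4 * (m : ℝ) ^ 3) = 4 * (q * m) ^ 4 / m := by field_simp
    have h4 : (q * m) ^ 4 ≤ (L : ℝ) ^ 4 := pow_le_pow_left₀ (by positivity) hqm 4
    have h5 : 4 * (q * m) ^ 4 / m ≤ 4 * (L : ℝ) ^ 4 / m := by gcongr
    linarith
  -- the three pieces
  have A1 : |ψ L - q ^ 4 * c| ≤ K * (4 * (L : ℝ) ^ 3 * m + 4 * (L : ℝ) ^ 4 / m) := by
    refine e.trans (mul_le_mul_of_nonneg_left ?_ hK)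
    have : q ^ 4 * ((m : ℝ) - 1) ^ 4 = (q * ((m : ℝ) - 1)) ^ 4 := by ring
    rw [this]; exact T1
  have A2 : |q ^ 4 * c - q ^ 4 * ((m : ℝ) ^ 4 * f)| ≤ K * (4 * (L : ℝ) ^ 4 / m) := by
    rw [← mul_sub, abs_mul, abs_of_nonneg (by positivity : (0 : ℝ) ≤ q ^ 4), abs_sub_comm]
    calc q ^ 4 * |(m : ℝ) ^ 4 * f - c| ≤ q ^ 4 * (K * ((m : ℝ) ^ 4 - ((m : ℝ) - 1) ^ 4)) :=
          mul_le_mul_of_nonneg_left ha (by positivity)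
      _ = K * (q ^ 4 * ((m : ℝ) ^ 4 - ((m : ℝ) - 1) ^ 4)) := by ring
      _ ≤ K * (4 * (L : ℝ) ^ 4 / m) := mul_le_mul_of_nonneg_left T2 hK
  have A3 : |q ^ 4 * ((m : ℝ) ^ 4 * f) - (L : ℝ) ^ 4 * f| ≤ K * (4 * (L : ℝ) ^ 3 * m) := by
    have h4 : (q * m) ^ 4 ≤ (L : ℝ) ^ 4 := pow_le_pow_left₀ (by positivity) hqm 4
    have : q ^ 4 * ((m : ℝ) ^ 4 * f) - (L : ℝ) ^ 4 * f = -(((L : ℝ) ^ 4 - (q * m) ^ 4) * f) := by ring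
    rw [this, abs_neg, abs_mul, abs_of_nonneg (by linarith : (0 : ℝ) ≤ (L : ℝ) ^ 4 - (q * m) ^ 4)]
    calc ((L : ℝ) ^ 4 - (q * m) ^ 4) * |f| ≤ (4 * (L : ℝ) ^ 3 * m) * K :=
          mul_le_mul T3 hf (abs_nonneg _) (by positivity)
      _ = K * (4 * (L : ℝ) ^ 3 * m) := by ring
  calc |ψ L - (L : ℝ) ^ 4 * f|
      ≤ |ψ L - q ^ 4 * c| + |q ^ 4 * c - (L : ℝ) ^ 4 * f| := abs_sub_le _ _ _
    _ ≤ |ψ L - q ^ 4 * c| + (|q ^ 4 * c - q ^ 4 * ((m : ℝ) ^ 4 * f)| +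
          |q ^ 4 * ((m : ℝ) ^ 4 * f) - (L : ℝ) ^ 4 * f|) := by
        gcongr; exact abs_sub_le _ _ _
    _ ≤ K * (4 * (L : ℝ) ^ 3 * m + 4 * (L : ℝ) ^ 4 / m) + (K * (4 * (L : ℝ) ^ 4 / m) + K * (4 * (L : ℝ) ^ 3 * m)) :=
        add_le_add A1 (add_le_add A2 A3)
    _ = 8 * K * ((L : ℝ) ^ 4 / m + (L : ℝ) ^ 3 * m) := by ring

variable {G : Type} [Group G] [TopologicalSpace G] [IsTopologicalGroup G] [CompactSpace G]
  [MeasurableSpace G] [BorelSpace G]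

/-- **(FS) for one lattice representation, all `β`, all `m ≥ 1`**: the sub-box estimate
`FreeEnergy.abs_torusLogPartition_sub_le`, the box bounds `FreeEnergy.zdZ_le` / `pow_le_zdZ` (for `|log Z(A_{m−1})|`), the
existence of the density `exists_hasFreeEnergyDensity_holds`, and the abstract lemma. -/
theorem abs_torusLogPartition_sub_density_le (r : LatticeRep G) :
    ∃ C : ℝ, 0 ≤ C ∧ ∀ (β : ℝ) (L m : ℕ) [NeZero L], 1 ≤ m →
      |torusLogPartition 4 r.ρ β L - (L : ℝ) ^ 4 * freeEnergyDensity 4 r.ρ β| ≤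
        C * |β| * ((L : ℝ) ^ 4 / m + (L : ℝ) ^ 3 * m) := by
  classical
  haveI : SecondCountableTopology G :=
    (r.continuous.isClosedEmbedding r.injective).isEmbedding.secondCountableTopology
  obtain ⟨M, hM0, hM⟩ := exists_bound_trace_re_nonneg r.ρ r.continuous
  set P : ℕ := Fintype.card {q : Fin 4 × Fin 4 // q.1 < q.2} with hP
  refine ⟨8 * (((r.N : ℝ) + M) * P), by positivity, ?_⟩
  intro β L m _ hm
  set K : ℝ := |β| * ((r.N : ℝ) + M) * P with hK
  have hK0 : 0 ≤ K := by positivity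
  -- the density
  obtain ⟨f, hfd⟩ := exists_hasFreeEnergyDensity_holds (d := 4) r.ρ r.continuous β
  have hfeq : freeEnergyDensity 4 r.ρ β = f := hfd.freeEnergyDensity_eq
  rw [hfeq]
  -- the box constant and its a-priori bound
  have hsub := fun (L' : ℕ) (hL' : 1 ≤ L') =>
    @FreeEnergy.abs_torusLogPartition_sub_le 4 r.N G _ _ _ _ _ _ r.ρ _ r.continuous M hM β L' m ⟨by omega⟩ hm
  set Zb : ℝ := ∫ U, ∏ p ∈ (Literature.Probability.LatticeModels.halfOpenBox 4 (m - 1) ×ˢ Finset.univ :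
      Finset (ZdPlaquette 4)), Real.exp (-β * ((r.N : ℝ) - plaquetteObs r.ρ p.1 p.2.1.1 p.2.1.2 U))
      ∂zdHaar 4 G with hZb
  have hcard : ((Literature.Probability.LatticeModels.halfOpenBox 4 (m - 1) ×ˢ Finset.univ :
      Finset (ZdPlaquette 4))).card = (m - 1) ^ 4 * P := by
    rw [Finset.card_product, Literature.Probability.LatticeModels.card_halfOpenBox, Finset.card_univ]
  have hZup := FreeEnergy.zdZ_le (d := 4) r.ρ r.continuous hM β
    (Literature.Probability.LatticeModels.halfOpenBox 4 (m - 1) ×ˢ Finset.univ)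
  have hZlo := FreeEnergy.pow_le_zdZ (d := 4) r.ρ r.continuous hM β
    (Literature.Probability.LatticeModels.halfOpenBox 4 (m - 1) ×ˢ Finset.univ)
  rw [hcard] at hZup hZlo
  have hZpos : 0 < Zb := lt_of_lt_of_le (pow_pos (Real.exp_pos _) _) hZlo
  have Hc : |Real.log Zb| ≤ K * (((m - 1 : ℕ) : ℝ)) ^ 4 := by
    rw [abs_le]
    constructor
    · have h := Real.log_le_log (pow_pos (Real.exp_pos _) _) hZlo
      rw [Real.log_pow, Real.log_exp] at h
      have : ((((m - 1) ^ 4 * P : ℕ)) : ℝ) * -(|β| * ((r.N : ℝ) + M)) = -(K * (((m - 1 : ℕ) : ℝ)) ^ 4) := by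
        rw [hK]; push_cast; ring
      linarith
    · have h := Real.log_le_log hZpos hZup
      rw [Real.log_pow, Real.log_exp] at h
      have : ((((m - 1) ^ 4 * P : ℕ)) : ℝ) * (|β| * ((r.N : ℝ) + M)) = K * (((m - 1 : ℕ) : ℝ)) ^ 4 := by
        rw [hK]; push_cast; ring
      linarith
  -- the sequence (extended by `0` at `L' = 0`, where the torus is not defined)
  let ψ : ℕ → ℝ := fun L' => if h : L' = 0 then 0 else
    (haveI : NeZero L' := ⟨h⟩; torusLogPartition 4 r.ρ β L')
  have hψ : ∀ (L' : ℕ) [NeZero L'], ψ L' = torusLogPartition 4 r.ρ β L' := fun L' _ =>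
    dif_neg (NeZero.ne L')
  have H1 : ∀ L' : ℕ, 1 ≤ L' → |ψ L' - (((L' / m) ^ 4 : ℕ) : ℝ) * Real.log Zb| ≤
      K * ((L' : ℝ) ^ 4 - (((L' / m) ^ 4 : ℕ) : ℝ) * (((m - 1 : ℕ) : ℝ)) ^ 4) := by
    intro L' hL'
    haveI : NeZero L' := ⟨by omega⟩
    rw [hψ L']
    have h := hsub L' hL'
    have e : |β| * ((r.N : ℝ) + M) * ((P : ℝ) * ((L' : ℝ) ^ 4 - (((L' / m) ^ 4 : ℕ) : ℝ) * (((m - 1 : ℕ) : ℝ)) ^ 4)) =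
        K * ((L' : ℝ) ^ 4 - (((L' / m) ^ 4 : ℕ) : ℝ) * (((m - 1 : ℕ) : ℝ)) ^ 4) := by rw [hK]; ring
    rw [← e, hP]
    exact h
  have H2 : Tendsto (fun L' : ℕ => (((L' + 1 : ℕ) : ℝ) ^ 4)⁻¹ * ψ (L' + 1)) atTop (𝓝 f) := by
    have : (fun L' : ℕ => (((L' + 1 : ℕ) : ℝ) ^ 4)⁻¹ * ψ (L' + 1)) =
        fun L' : ℕ => (((L' + 1 : ℕ) : ℝ) ^ 4)⁻¹ * torusLogPartition 4 r.ρ β (L' + 1) :=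
      funext fun L' => by rw [hψ (L' + 1)]
    rw [this]; exact hfd
  have main := abs_sub_limit_le_of_subbox hm hK0 H1 H2 Hc L (Nat.one_le_iff_ne_zero.2 (NeZero.ne L))
  rw [hψ L] at main
  have e : 8 * K * ((L : ℝ) ^ 4 / m + (L : ℝ) ^ 3 * m) = 8 * (((r.N : ℝ) + M) * P) * |β| * ((L : ℝ) ^ 4 / m + (L : ℝ) ^ 3 * m) := by
    rw [hK]; ring
  rw [← e]; exact main

/-- **(FS) PROVED.** -/
theorem finiteSizeFreeEnergy : FiniteSizeFreeEnergy := by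
  intro G _ _ _ _
  letI : MeasurableSpace G := borel G
  haveI : BorelSpace G := ⟨rfl⟩
  intro r
  obtain ⟨C, hC0, h⟩ := abs_torusLogPartition_sub_density_le r
  refine ⟨C, hC0, fun β L m _ hm _ => ?_⟩
  refine (h β L m (by omega)).trans ?_
  have hx : 0 ≤ (L : ℝ) ^ 4 / m + (L : ℝ) ^ 3 * m := by positivity
  have : C * |β| ≤ C * (1 + |β|) := mul_le_mul_of_nonneg_left (by linarith [abs_nonneg β]) hC0
  exact mul_le_mul_of_nonneg_right this hx

end FiniteSize

end Summit.QuantumFields.YangMills.Cruxes.IR.LargeFieldRarityChessboard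

end
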